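import Literature.Analysis.FluidPDE.DriftDiffusionMaxPrinciple
import HarnessLib

/-!
# ArgmaxDoorsAlmostArgmax — the S35 sup-norm engine for BOUNDED, NON-DECAYING fields
# (penalised / Omori–Yau form; nsreg-p1 g29's seed σ1 «ancient argmax law» asked for exactly this plate)

`ArgmaxDoorsSupNorm` needs `|W(t,x)| → 0` at spatial infinity uniformly in `t`, so that the maximum of
`|W(t,·)|` is attained; bounded ancient / Liouville-class profiles do not decay. Here NO decay is assumed:
penalise with `w_ε(x) = (1 + ε|x|²)⁻¹`; `w_ε|W|²` (times the integrating factor) attains its maximum over the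
slab; for `ε` small its maximiser `(t₀,x₀)` has `t₀ > 0`, is a GLOBAL maximiser of `x ↦ w_ε(x)|W(t₀,x)|²`
and a `(1−δ)`-ALMOST ARGMAX of `|W(t₀,·)|`, and `W(t₀,x₀) ≠ 0`; the growth hypothesis is asked only at such
points, with an allowance `η(ε) → 0` for the penalisation error a PDE user incurs there (for the vorticity of
a bounded-velocity solution: `O(νε + ‖u‖_∞√ε)` from `∇w_ε/w_ε`, `Δw_ε/w_ε`).

* `norm_le_mul_exp_of_almostArgmax_inner_timeDeriv_le` — `|W(0,·)| ≤ M ⇒ |W(t,·)| ≤ M e^{Φ(t)−Φ(0)}`.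

HONEST FRAME / WHAT THIS IS NOT: a tool for regularity / Liouville CRITERIA (S-door lane, LEAD ns-s30-p1 g3,
`--supports stmt-NavierStokesRegularity-0056 --as helper`); item 0056 `NoTypeII`, the wall cruxes and NS
regularity are NOT proved; no Literature fact is taken as a hypothesis; nothing here is a route or a summit
statement.
-/

noncomputable section

open Set Function Filter Metric MeasureTheory
open scoped RealInnerProductSpace Laplacian ContDiff Topology

set_option linter.dupNamespace false

namespace Summit.NavierStokesRegularity.NavierStokesRegularity.Theorems.ArgmaxDoors

open Literature.Analysis.FluidPDE

variable {E : Type*} [NormedAddCommGroup E] [InnerProductSpace ℝ E] [FiniteDimensional ℝ E]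
variable {F : Type*} [NormedAddCommGroup F] [InnerProductSpace ℝ F]

set_option maxHeartbeats 800000 in
-- one long contradiction argument (penalisation + compactness + one-sided Fermat) in a single declaration
/-- **Sup-norm comparison from growth at PENALISED ALMOST-ARGMAXIMA** (bounded, non-decaying fields;
the Omori–Yau form of the S35 engine). Let `W : [0,T] × E → F` be jointly `C^∞` and BOUNDED on the
closed slab; `Φ` continuous on `[0,T]` with one-sided derivative `φ`; `0 < δ`; `η : ℝ → ℝ` with
`η(ε) → 0` as `ε ↓ 0`. Suppose that for every `ε ∈ (0,1]`, every `t ∈ (0,T]` and every point `x̄`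
which (i) maximises `x ↦ (1 + ε|x|²)⁻¹|W(t,x)|²` globally, (ii) is a `(1−δ)`-almost argmax of `|W(t,·)|`
(`(1−δ)|W(t,x)| ≤ |W(t,x̄)|` for all `x`) and (iii) has `W(t,x̄) ≠ 0`, the growth bound
`⟪W(t,x̄), ∂ₜW(t,x̄)⟫ ≤ (φ(t) + η(ε))|W(t,x̄)|²` holds. Then `|W(0,·)| ≤ M` gives
`|W(t,x)| ≤ M e^{Φ(t) − Φ(0)}` on the slab. Proof: for `λ > 0`, a violation of
`e^{−2Φ−2λt}|W|² ≤ e^{−2Φ(0)}M²` at `(t₁,x₁)` is contradicted by penalising with `ε` so small that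
`η(ε) < λ`, the penalised value at `(t₁,x₁)` stays above the `t = 0` bound, and the penalised maximum over
the slab (attained: the weight kills infinity) exceeds `(1−δ)²·sup`; at the maximiser `t₀ > 0`, (i)–(iii)
hold, and one-sided Fermat in `t` contradicts the growth bound. [folklore; cf. Omori–Yau maximum principle] -/
theorem norm_le_mul_exp_of_almostArgmax_inner_timeDeriv_le {T : ℝ} {W : ℝ → E → F}
    (hW : IsSmoothSpaceTimeOn (Icc 0 T) W)
    (hbdd : ∃ K : ℝ, ∀ t ∈ Icc 0 T, ∀ x : E, ‖W t x‖ ≤ K)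
    {Φ φ : ℝ → ℝ} (hΦc : ContinuousOn Φ (Icc 0 T))
    (hΦ : ∀ t ∈ Icc 0 T, HasDerivWithinAt Φ (φ t) (Icc 0 T) t)
    {δ : ℝ} (hδ : 0 < δ) {η : ℝ → ℝ} (hη : Tendsto η (𝓝[>] 0) (𝓝 0))
    (hgrow : ∀ ε : ℝ, 0 < ε → ε ≤ 1 → ∀ t ∈ Icc 0 T, 0 < t → ∀ x₀ : E,
      (∀ x, (1 + ε * ‖x‖ ^ 2)⁻¹ * ‖W t x‖ ^ 2 ≤ (1 + ε * ‖x₀‖ ^ 2)⁻¹ * ‖W t x₀‖ ^ 2) →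
      (∀ x, (1 - δ) * ‖W t x‖ ≤ ‖W t x₀‖) → W t x₀ ≠ 0 →
      ⟪W t x₀, timeDerivWithin (Icc 0 T) W t x₀⟫ ≤ (φ t + η ε) * ‖W t x₀‖ ^ 2)
    {M : ℝ} (hM : ∀ x, ‖W 0 x‖ ≤ M) :
    ∀ t ∈ Icc 0 T, ∀ x, ‖W t x‖ ≤ M * Real.exp (Φ t - Φ 0) := by
  have hM0 : 0 ≤ M := (norm_nonneg _).trans (hM 0)
  by_cases hT : T < 0
  · intro t ht; exact absurd (ht.1.trans ht.2) (not_le.2 hT)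
  push Not at hT
  have h0T : (0 : ℝ) ∈ Icc 0 T := ⟨le_rfl, hT⟩
  obtain ⟨K, hK⟩ := hbdd
  have hK0 : 0 ≤ K := (norm_nonneg _).trans (hK 0 h0T 0)
  obtain ⟨CΦ, hCΦ⟩ := (isCompact_Icc (a := (0 : ℝ)) (b := T)).exists_bound_of_continuousOn hΦc
  have hCΦ0 : 0 ≤ CΦ := (norm_nonneg _).trans (hCΦ 0 h0T)
  set B : ℝ := Real.exp (-(2 * Φ 0)) * M ^ 2 with hB
  have hB0 : 0 ≤ B := by positivity
  -- ### reduction to the weighted bound for every `λ > 0`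
  suffices key : ∀ lam : ℝ, 0 < lam →
      ∀ t ∈ Icc 0 T, ∀ x, Real.exp (-(2 * Φ t + 2 * lam * t)) * ‖W t x‖ ^ 2 ≤ B by
    intro t ht x
    have hlim : Real.exp (-(2 * Φ t)) * ‖W t x‖ ^ 2 ≤ B := by
      have hc : Continuous fun lam : ℝ => Real.exp (-(2 * Φ t + 2 * lam * t)) * ‖W t x‖ ^ 2 := by
        fun_prop
      have h0 : Tendsto (fun lam : ℝ => Real.exp (-(2 * Φ t + 2 * lam * t)) * ‖W t x‖ ^ 2) (𝓝[>] 0)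
          (𝓝 (Real.exp (-(2 * Φ t)) * ‖W t x‖ ^ 2)) := by
        have := (hc.tendsto 0).mono_left (nhdsWithin_le_nhds (s := Ioi (0 : ℝ)))
        simpa using this
      exact le_of_tendsto h0 (eventually_nhdsWithin_of_forall fun lam hlam => key lam hlam t ht x)
    have hsq : ‖W t x‖ ^ 2 ≤ (M * Real.exp (Φ t - Φ 0)) ^ 2 := by
      have hE : 0 < Real.exp (-(2 * Φ t)) := Real.exp_pos _
      have h1 : ‖W t x‖ ^ 2 ≤ B / Real.exp (-(2 * Φ t)) := by
        rw [le_div_iff₀ hE, mul_comm]; exact hlim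
      have h2 : B / Real.exp (-(2 * Φ t)) = (M * Real.exp (Φ t - Φ 0)) ^ 2 := by
        rw [hB, mul_pow, ← Real.exp_nat_mul, div_eq_iff hE.ne', mul_comm (M ^ 2), mul_assoc,
          mul_comm (M ^ 2), ← mul_assoc, ← Real.exp_add]
        congr 1
        congr 1
        push_cast
        ring
      rwa [h2] at h1
    exact (pow_le_pow_iff_left₀ (norm_nonneg _) (by positivity) two_ne_zero).mp hsq
  intro lam hlam
  by_contra hcon
  push Not at hcon
  obtain ⟨t₁, ht₁, x₁, hlt⟩ := hcon
  -- ### the time weight `w`, the unpenalised size `g`, its supremum `S₀`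
  set w : ℝ → ℝ := fun t => Real.exp (-(2 * Φ t + 2 * lam * t)) with hw
  have hwpos : ∀ t, 0 < w t := fun t => Real.exp_pos _
  have hwle : ∀ t ∈ Icc (0 : ℝ) T, w t ≤ Real.exp (2 * CΦ) := fun t ht => by
    rw [hw, Real.exp_le_exp]
    have h1 : |Φ t| ≤ CΦ := by simpa [Real.norm_eq_abs] using hCΦ t ht
    have h2 : -Φ t ≤ CΦ := (neg_le_abs _).trans h1
    nlinarith [ht.1, hlam]
  set g : ℝ → E → ℝ := fun t x => w t * ‖W t x‖ ^ 2 with hg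
  have hg0 : ∀ t x, 0 ≤ g t x := fun t x => mul_nonneg (hwpos t).le (sq_nonneg _)
  set Gmax : ℝ := Real.exp (2 * CΦ) * K ^ 2 with hGmax
  have hgle : ∀ t ∈ Icc 0 T, ∀ x, g t x ≤ Gmax := fun t ht x =>
    mul_le_mul (hwle t ht) (pow_le_pow_left₀ (norm_nonneg _) (hK t ht x) 2) (sq_nonneg _)
      (Real.exp_pos _).le
  set Sset : Set ℝ := (fun z : ℝ × E => g z.1 z.2) '' (Icc 0 T ×ˢ (univ : Set E)) with hSset
  have hSne : Sset.Nonempty := ⟨g t₁ x₁, ⟨(t₁, x₁), mk_mem_prod ht₁ (mem_univ _), rfl⟩⟩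
  have hSbdd : BddAbove Sset := ⟨Gmax, by
    rintro r ⟨⟨t, x⟩, hz, rfl⟩
    exact hgle t (mem_prod.1 hz).1 x⟩
  set S₀ : ℝ := sSup Sset with hS₀
  have hgS₀ : ∀ t ∈ Icc 0 T, ∀ x, g t x ≤ S₀ := fun t ht x =>
    le_csSup hSbdd ⟨(t, x), mk_mem_prod ht (mem_univ _), rfl⟩
  set S' : ℝ := g t₁ x₁ with hS'
  have hS'B : B < S' := hlt
  have hS'pos : 0 < S' := hB0.trans_lt hS'B
  have hS₀pos : 0 < S₀ := hS'pos.trans_le (hgS₀ t₁ ht₁ x₁)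
  -- ### the almost-argmax ratio `q = max (1−δ)² 0 < 1` and a near-maximiser of `g`
  set q : ℝ := if δ < 1 then (1 - δ) ^ 2 else 0 with hq
  have hq1 : q < 1 := by
    rw [hq]; split_ifs with h
    · nlinarith
    · exact zero_lt_one
  have hq0 : 0 ≤ q := by rw [hq]; split_ifs <;> positivity
  have hmid : q * S₀ < S₀ := by nlinarith
  obtain ⟨r, ⟨⟨ts, xs⟩, hzs, rfl⟩, hrs⟩ := exists_lt_of_lt_csSup hSne (hmid.trans_le le_rfl)
  have hts : ts ∈ Icc 0 T := (mem_prod.1 hzs).1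
  have hgs : q * S₀ < g ts xs := hrs
  have hgspos : 0 < g ts xs := (mul_nonneg hq0 hS₀pos.le).trans_lt hgs
  -- ### choice of `ε`: (a) `η ε < lam`, (b) `S' pw(x₁) > B`, (c) `g(ts,xs) pw(xs) > q S₀`, (d) `ε ≤ 1`
  have hηev : ∀ᶠ ε in 𝓝[>] (0 : ℝ), |η ε| < lam := by
    have h := Metric.tendsto_nhds.1 hη lam hlam
    filter_upwards [h] with ε hε
    simpa [Real.dist_eq] using hε
  obtain ⟨ε₁, hε₁, hη₁⟩ : ∃ ε₁ : ℝ, 0 < ε₁ ∧ ∀ ε : ℝ, 0 < ε → ε < ε₁ → |η ε| < lam := by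
    rcases (nhdsWithin_hasBasis nhds_basis_ball (Ioi (0 : ℝ))).eventually_iff.1 hηev with ⟨ρ, hρ, h⟩
    refine ⟨ρ, hρ, fun ε hε hερ => h ⟨?_, hε⟩⟩
    simpa [Real.dist_eq, abs_of_pos hε] using hερ
  -- a generic smallness lemma: for `c < v` (`v > 0`) there is `ε₀ > 0` with `c < v·pw x` for `ε < ε₀`
  have hsmall : ∀ (c v : ℝ) (x : E), 0 < v → c < v → ∃ ε₀ : ℝ, 0 < ε₀ ∧ ∀ ε : ℝ, 0 < ε → ε < ε₀ →
      c < v * (1 + ε * ‖x‖ ^ 2)⁻¹ := by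
    intro c v x hv hcv
    have hD : 0 < max c 0 * ‖x‖ ^ 2 + v := by positivity
    refine ⟨(v - c) / (max c 0 * ‖x‖ ^ 2 + v), div_pos (by linarith) hD, fun ε hε hεlt => ?_⟩
    have hden : 0 < 1 + ε * ‖x‖ ^ 2 := by positivity
    rw [← div_eq_mul_inv, lt_div_iff₀ hden]
    have hc' : c * (ε * ‖x‖ ^ 2) ≤ max c 0 * (ε * ‖x‖ ^ 2) :=
      mul_le_mul_of_nonneg_right (le_max_left _ _) (by positivity)
    have hm0 : 0 ≤ max c 0 * ‖x‖ ^ 2 := by positivity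
    have hkey : max c 0 * ‖x‖ ^ 2 * ε < v - c := by
      have h1 : max c 0 * ‖x‖ ^ 2 * ε ≤ max c 0 * ‖x‖ ^ 2 * ((v - c) / (max c 0 * ‖x‖ ^ 2 + v)) :=
        mul_le_mul_of_nonneg_left hεlt.le hm0
      have h2 : max c 0 * ‖x‖ ^ 2 * ((v - c) / (max c 0 * ‖x‖ ^ 2 + v)) ≤ v - c := by
        rw [mul_div_assoc']
        rw [div_le_iff₀ hD]
        nlinarith [hv]
      rcases eq_or_lt_of_le hm0 with h0 | hpos
      · rw [← h0, zero_mul]; linarith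
      · have h1' : max c 0 * ‖x‖ ^ 2 * ε < max c 0 * ‖x‖ ^ 2 * ((v - c) / (max c 0 * ‖x‖ ^ 2 + v)) :=
          mul_lt_mul_of_pos_left hεlt hpos
        linarith
    nlinarith
  obtain ⟨ε₂, hε₂, hb₂⟩ := hsmall B S' x₁ hS'pos hS'B
  obtain ⟨ε₃, hε₃, hc₃⟩ := hsmall (q * S₀) (g ts xs) xs hgspos hgs
  set ε : ℝ := min (min ε₁ ε₂) (min ε₃ 1) / 2 with hεdef
  have hεpos : 0 < ε := by rw [hεdef]; positivity
  have hεlt₁ : ε < ε₁ := by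
    rw [hεdef]; linarith [min_le_left (min ε₁ ε₂) (min ε₃ 1), min_le_left ε₁ ε₂]
  have hεlt₂ : ε < ε₂ := by
    rw [hεdef]; linarith [min_le_left (min ε₁ ε₂) (min ε₃ 1), min_le_right ε₁ ε₂]
  have hεlt₃ : ε < ε₃ := by
    rw [hεdef]; linarith [min_le_right (min ε₁ ε₂) (min ε₃ 1), min_le_left ε₃ 1]
  have hεle1 : ε ≤ 1 := by
    rw [hεdef]; linarith [min_le_right (min ε₁ ε₂) (min ε₃ 1), min_le_right ε₃ 1,
      le_min (le_min hε₁.le hε₂.le) (le_min hε₃.le zero_le_one)]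
  have hηε : η ε < lam := lt_of_abs_lt (hη₁ ε hεpos hεlt₁)
  set pw : E → ℝ := fun x => (1 + ε * ‖x‖ ^ 2)⁻¹ with hpwdef
  have hpwpos : ∀ x : E, 0 < pw x := fun x => by rw [hpwdef]; positivity
  have hpw1 : ∀ x : E, pw x ≤ 1 := fun x => by
    rw [hpwdef]; simp only
    rw [inv_le_one_iff₀]
    right; nlinarith [sq_nonneg ‖x‖, hεpos.le]
  have hpwR : ∀ {R : ℝ}, 0 ≤ R → ∀ {x : E}, R ≤ ‖x‖ → pw x ≤ (1 + ε * R ^ 2)⁻¹ := by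
    intro R hR x hx
    rw [hpwdef]; simp only
    have h1 : 0 < 1 + ε * R ^ 2 := by positivity
    rw [inv_le_inv₀ (by positivity) h1]
    nlinarith [mul_le_mul_of_nonneg_left (pow_le_pow_left₀ hR hx 2) hεpos.le]
  -- ### the penalised function `ψ = g · pw` and its maximum over the slab
  set ψ : ℝ × E → ℝ := fun z => g z.1 z.2 * pw z.2 with hψ
  set S'' : ℝ := S' * pw x₁ with hS''
  have hS''B : B < S'' := hb₂ ε hεpos hεlt₂
  have hS''pos : 0 < S'' := hB0.trans_lt hS''B
  -- outside a large ball `ψ < S''`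
  obtain ⟨R, hR0, hout⟩ : ∃ R : ℝ, 0 ≤ R ∧ ∀ t ∈ Icc 0 T, ∀ x : E, R ≤ ‖x‖ → ψ (t, x) < S'' := by
    -- `ψ ≤ Gmax · (1 + ε R²)⁻¹ < S''` once `R² > (Gmax/S'' − 1)/ε`
    set R : ℝ := Real.sqrt ((2 * Gmax / S'' + 1) / ε) with hRdef
    have hR0 : 0 ≤ R := Real.sqrt_nonneg _
    have hR2 : R ^ 2 = (2 * Gmax / S'' + 1) / ε := Real.sq_sqrt (by positivity)
    refine ⟨R, hR0, fun t ht x hx => ?_⟩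
    have hGmax0 : 0 ≤ Gmax := by positivity
    have h1 : ψ (t, x) ≤ Gmax * (1 + ε * R ^ 2)⁻¹ := by
      simp only [hψ]
      exact mul_le_mul (hgle t ht x) (hpwR hR0 hx) (hpwpos x).le hGmax0
    have h2 : Gmax * (1 + ε * R ^ 2)⁻¹ < S'' := by
      rw [hR2, mul_div_cancel₀ _ hεpos.ne']
      have hden : (0 : ℝ) < 1 + (2 * Gmax / S'' + 1) := by positivity
      rw [mul_inv_lt_iff₀' hden]
      have : 2 * Gmax / S'' * S'' = 2 * Gmax := div_mul_cancel₀ _ hS''pos.ne'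
      nlinarith
    exact h1.trans_lt h2
  set R' : ℝ := max R ‖x₁‖ with hR'
  set Kc : Set (ℝ × E) := Icc 0 T ×ˢ Metric.closedBall (0 : E) R' with hKc
  have hKcpt : IsCompact Kc := isCompact_Icc.prod (isCompact_closedBall _ _)
  have h1K : (t₁, x₁) ∈ Kc := mk_mem_prod ht₁ (by simp [hR'])
  have hψc : ContinuousOn ψ Kc := by
    have hvc : ContinuousOn (uncurry W) Kc := hW.continuousOn.mono (prod_mono le_rfl (subset_univ _))
    have hΦK : ContinuousOn (fun z : ℝ × E => Φ z.1) Kc :=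
      hΦc.comp continuous_fst.continuousOn fun z hz => (mem_prod.mp hz).1
    have hwc : ContinuousOn (fun z : ℝ × E => w z.1) Kc := by
      have hlin : Continuous fun z : ℝ × E => 2 * lam * z.1 := by fun_prop
      exact ((hΦK.const_smul (2 : ℝ)).add hlin.continuousOn).neg.rexp.congr fun z _ => by
        simp [hw, smul_eq_mul]
    have hpwc : Continuous fun z : ℝ × E => pw z.2 := by
      rw [hpwdef]
      exact Continuous.inv₀ (by fun_prop) fun z => by positivity
    have hA : ContinuousOn (fun z : ℝ × E => w z.1 * ‖uncurry W z‖ ^ 2) Kc :=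
      hwc.mul (hvc.norm.pow 2)
    have hpwc' : ContinuousOn (fun z : ℝ × E => pw z.2) Kc := hpwc.continuousOn
    have hψ' : ContinuousOn (fun z : ℝ × E => (w z.1 * ‖uncurry W z‖ ^ 2) * pw z.2) Kc :=
      ContinuousOn.mul hA hpwc'
    refine hψ'.congr fun z _ => ?_
    simp only [hψ, hg, uncurry]
  obtain ⟨⟨t₀, x₀⟩, h0K, hmaxK⟩ := hKcpt.exists_isMaxOn ⟨(t₁, x₁), h1K⟩ hψc
  have ht₀ : t₀ ∈ Icc 0 T := (mem_prod.mp h0K).1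
  have hS''le : S'' ≤ ψ (t₀, x₀) := isMaxOn_iff.mp hmaxK (t₁, x₁) h1K
  have hglob : ∀ t ∈ Icc 0 T, ∀ x : E, ψ (t, x) ≤ ψ (t₀, x₀) := by
    intro t ht x
    by_cases hx : ‖x‖ ≤ R'
    · exact isMaxOn_iff.mp hmaxK (t, x) (mk_mem_prod ht (by simpa using hx))
    · have hRx : R ≤ ‖x‖ := (le_max_left _ _).trans (not_le.mp hx).le
      exact ((hout t ht x hRx).trans_le hS''le).le
  -- `t₀ > 0`
  have ht₀pos : 0 < t₀ := by
    rcases ht₀.1.eq_or_lt with h | h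
    · exfalso
      have h1 : ψ (t₀, x₀) ≤ B := by
        have hg0x : g 0 x₀ ≤ B := by
          simp only [hg, hw, hB, mul_zero, add_zero]
          exact mul_le_mul_of_nonneg_left (pow_le_pow_left₀ (norm_nonneg _) (hM x₀) 2)
            (Real.exp_pos _).le
        calc ψ (t₀, x₀) = g 0 x₀ * pw x₀ := by simp [hψ, ← h]
          _ ≤ g 0 x₀ * 1 := mul_le_mul_of_nonneg_left (hpw1 x₀) (hg0 0 x₀)
          _ ≤ B := by rw [mul_one]; exact hg0x
      linarith
    · exact h
  -- ### the three properties of `x₀` at time `t₀`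
  have hwt₀ : 0 < w t₀ := hwpos t₀
  have hpen : ∀ x, (1 + ε * ‖x‖ ^ 2)⁻¹ * ‖W t₀ x‖ ^ 2 ≤ (1 + ε * ‖x₀‖ ^ 2)⁻¹ * ‖W t₀ x₀‖ ^ 2 := by
    intro x
    have h := hglob t₀ ht₀ x
    simp only [hψ, hg] at h
    -- `w t₀ * |W x|² * pw x ≤ w t₀ * |W x₀|² * pw x₀`
    have h' : w t₀ * (pw x * ‖W t₀ x‖ ^ 2) ≤ w t₀ * (pw x₀ * ‖W t₀ x₀‖ ^ 2) := by
      calc w t₀ * (pw x * ‖W t₀ x‖ ^ 2) = w t₀ * ‖W t₀ x‖ ^ 2 * pw x := by ring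
        _ ≤ w t₀ * ‖W t₀ x₀‖ ^ 2 * pw x₀ := h
        _ = w t₀ * (pw x₀ * ‖W t₀ x₀‖ ^ 2) := by ring
    have h'' := le_of_mul_le_mul_left h' hwt₀
    simpa [hpwdef] using h''
  have hV0pos : 0 < ‖W t₀ x₀‖ ^ 2 := by
    by_contra h
    have h' : ‖W t₀ x₀‖ ^ 2 = 0 := le_antisymm (not_lt.mp h) (sq_nonneg _)
    have : ψ (t₀, x₀) = 0 := by simp [hψ, hg, h']
    linarith
  have hne : W t₀ x₀ ≠ 0 := by
    intro h0; rw [h0, norm_zero] at hV0pos; simp at hV0pos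
  have halmost : ∀ x, (1 - δ) * ‖W t₀ x‖ ≤ ‖W t₀ x₀‖ := by
    intro x
    by_cases hδ1 : δ < 1
    · -- `q = (1−δ)²`, and `q S₀ < g(ts,xs) pw(xs) = ψ(ts,xs) ≤ ψ(t₀,x₀) ≤ g t₀ x₀`
      have hqq : q = (1 - δ) ^ 2 := by rw [hq, if_pos hδ1]
      have hchain : q * S₀ < g t₀ x₀ := by
        calc q * S₀ < g ts xs * pw xs := hc₃ ε hεpos hεlt₃
          _ = ψ (ts, xs) := rfl
          _ ≤ ψ (t₀, x₀) := hglob ts hts xs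
          _ = g t₀ x₀ * pw x₀ := rfl
          _ ≤ g t₀ x₀ * 1 := mul_le_mul_of_nonneg_left (hpw1 x₀) (hg0 t₀ x₀)
          _ = g t₀ x₀ := mul_one _
      have hgx : g t₀ x ≤ S₀ := hgS₀ t₀ ht₀ x
      -- so `(1−δ)² w |W x|² ≤ (1−δ)² S₀ < w |W x₀|²`... with `w = w t₀ > 0`
      have h1 : (1 - δ) ^ 2 * (w t₀ * ‖W t₀ x‖ ^ 2) ≤ w t₀ * ‖W t₀ x₀‖ ^ 2 := by
        have := mul_le_mul_of_nonneg_left hgx (sq_nonneg (1 - δ))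
        rw [← hqq] at this ⊢
        exact this.trans hchain.le
      have h2 : ((1 - δ) * ‖W t₀ x‖) ^ 2 ≤ ‖W t₀ x₀‖ ^ 2 := by
        have h1' : w t₀ * (((1 - δ) * ‖W t₀ x‖) ^ 2) ≤ w t₀ * ‖W t₀ x₀‖ ^ 2 := by
          calc w t₀ * (((1 - δ) * ‖W t₀ x‖) ^ 2) = (1 - δ) ^ 2 * (w t₀ * ‖W t₀ x‖ ^ 2) := by ring
            _ ≤ w t₀ * ‖W t₀ x₀‖ ^ 2 := h1
        exact le_of_mul_le_mul_left h1' hwt₀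
      have h1δ : 0 ≤ (1 - δ) * ‖W t₀ x‖ := mul_nonneg (by linarith) (norm_nonneg _)
      exact (pow_le_pow_iff_left₀ h1δ (norm_nonneg _) two_ne_zero).1 h2
    · have : (1 - δ) * ‖W t₀ x‖ ≤ 0 :=
        mul_nonpos_of_nonpos_of_nonneg (by linarith) (norm_nonneg _)
      exact this.trans (norm_nonneg _)
  -- ### the growth hypothesis and one-sided Fermat in time
  have hinner : ⟪W t₀ x₀, timeDerivWithin (Icc 0 T) W t₀ x₀⟫ ≤ (φ t₀ + η ε) * ‖W t₀ x₀‖ ^ 2 :=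
    hgrow ε hεpos hεle1 t₀ ht₀ ht₀pos x₀ hpen halmost hne
  have hγ : HasDerivWithinAt (fun s => W s x₀) (timeDerivWithin (Icc 0 T) W t₀ x₀) (Icc 0 T) t₀ := by
    rw [timeDerivWithin_apply]
    exact (hW.differentiableWithinAt_time ht₀ x₀).hasDerivWithinAt
  have hf : HasDerivWithinAt (fun s : ℝ => -(2 * Φ s + 2 * lam * s)) (-(2 * φ t₀ + 2 * lam))
      (Icc 0 T) t₀ := by
    have h1 : HasDerivWithinAt (fun s : ℝ => 2 * lam * s) (2 * lam) (Icc 0 T) t₀ := by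
      have h := ((hasDerivAt_id t₀).const_mul (2 * lam)).hasDerivWithinAt (s := Icc 0 T)
      simpa using h
    exact (((hΦ t₀ ht₀).const_mul 2).add h1).neg
  have hk : HasDerivWithinAt (fun s => (w s * ‖W s x₀‖ ^ 2) * pw x₀)
      ((w t₀ * (-(2 * φ t₀ + 2 * lam)) * ‖W t₀ x₀‖ ^ 2 +
        w t₀ * (2 * ⟪W t₀ x₀, timeDerivWithin (Icc 0 T) W t₀ x₀⟫)) * pw x₀) (Icc 0 T) t₀ :=
    (hf.exp.mul hγ.norm_sq).mul_const _
  have htime := derivWithin_Icc_nonneg_of_forall_le ht₀ ht₀pos hk (fun s hs => by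
    have h := hglob s hs x₀
    simpa [hψ, hg] using h)
  -- contradiction
  have hp0 : 0 < pw x₀ := hpwpos x₀
  have h1 : 0 < w t₀ * (lam - η ε) * ‖W t₀ x₀‖ ^ 2 * pw x₀ := by
    have : 0 < lam - η ε := by linarith
    positivity
  have h2 : w t₀ * ⟪W t₀ x₀, timeDerivWithin (Icc 0 T) W t₀ x₀⟫ ≤
      w t₀ * ((φ t₀ + η ε) * ‖W t₀ x₀‖ ^ 2) := mul_le_mul_of_nonneg_left hinner hwt₀.le
  nlinarith [h1, h2, hp0, mul_le_mul_of_nonneg_right h2 hp0.le]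

end Summit.NavierStokesRegularity.NavierStokesRegularity.Theorems.ArgmaxDoors

end
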